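import Summits.NavierStokesRegularity.NavierStokesRegularity.Theses.QuantisedSymmetry
import Summits.NavierStokesRegularity.NavierStokesRegularity.Theses.Blowup
import Summits.NavierStokesRegularity.NavierStokesRegularity.Theorems.QuantisedSymmetryPolyhedralTruncationBridge
import Summits.NavierStokesRegularity.NavierStokesRegularity.Theorems.QuantisedSymmetryLiouvilleKillsProfile
import Summits.NavierStokesRegularity.NavierStokesRegularity.Theorems.FilamentSkeletonRssRdssProfileTruncation
import Summits.NavierStokesRegularity.NavierStokesRegularity.Theorems.QuantisedSymmetryPolyhedralDssProfileExistsStubPeriodWindow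
import Summits.NavierStokesRegularity.NavierStokesRegularity.Theorems.QuantisedSymmetryPolyhedralDssProfileExistsStubNoSmallConstant
import HarnessLib

/-!
# Strategist companion S21g15 — crux `QuantisedSymmetry.PolyhedralDssProfileExists`
  (stmt-NavierStokesRegularity-1404), independent census family `-s`, generation 15

Kernel-checked backbone of `STRATEGY-CENSUS-s21.md` (this generation). Nothing here is a new
route item; every theorem is glue over LANDED tree theorems.

* §0 `crux_decides` — the crux ALONE refutes Clay (A): `C → ¬NavierStokesRegularity`
  (`closes` + `quantisedSymmetry_polyhedralTruncationBridge_proof` + `ClayUniqueness_holds`).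
* §1 summit-down intermediates `W` with `C ⇒ W` that can stand in a re-glued `closes`:
  `W1 = Blowup.BlowupTypeIDssProfile` (drop the group), `W3 = Blowup.BlowupExists` (X5a);
  both decide the summit by tree theorems (`W1_imp_W3`, `W3_decides`); and the unusable
  `W5 = ¬PolyhedralTypeILiouville` (drop DSS: a bounded ancient solution is not a blow-up).
* §2 the best honest split `C ⇐ SelT ∧ SelDss` (bridge split through `W5`), assembly proved,
  both converses recorded (each piece is NECESSARY; neither is known; neither has a plan).
* §3 the rigid strengthening `S⁺ = SteadyPolyhedralProfileExists` (λ-continuous) implies `C`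
  and is REFUTED in the tree (`not_steady`: Chae–Wolf period window N1 + no-small-constant N2).
-/

namespace Summit.NavierStokesRegularity.NavierStokesRegularity.Cruxes.PolyhedralDssProfileExists.S21g15

open MeasureTheory Set
open Literature.Analysis.FluidPDE
open Summit.NavierStokesRegularity.NavierStokesRegularity.Theses
open Summit.NavierStokesRegularity.NavierStokesRegularity.Theorems

/-! ## §0 The crux decides the summit (negatively) -/

/-- `C → ¬S`: with the landed bridge (stmt-11331) and ClayUniqueness (stmt-0153) the route's
deciding theorem consumes only the crux. [folklore] -/
theorem crux_decides (hX : QuantisedSymmetry.PolyhedralDssProfileExists) :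
    ¬ _root_.NavierStokesRegularity :=
  QuantisedSymmetry.closes hX quantisedSymmetry_polyhedralTruncationBridge_proof
    QuantisedSymmetry.ClayUniqueness_holds

/-! ## §1 Summit-down weaker intermediates -/

/-- W1 (drop the group): the crux negates Tsai's Type-I (rotated) DSS Liouville conjecture,
i.e. implies `Blowup.BlowupTypeIDssProfile` (stmt-0155). [folklore] -/
theorem crux_imp_W1 (hX : QuantisedSymmetry.PolyhedralDssProfileExists) :
    Blowup.BlowupTypeIDssProfile := by
  obtain ⟨G, -, -, -, c, hc, u, hanc, hmeas, hdss, hdec, -, hnt⟩ := hX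
  intro h
  exact hnt ((h c).1 hc u hanc hmeas hdss hdec)

/-- W1 ⇒ W3: a Type-I (rotated) DSS profile gives a finite-lifespan Leray–Hopf classical
solution from a rapidly decaying datum (X5a = `Blowup.BlowupExists`), by the landed rotated
truncation bridge `filamentSkeletonRss_rdssProfileTruncation_proof` (stmt-11289). [folklore] -/
theorem W1_imp_W3 (h : Blowup.BlowupTypeIDssProfile) : Blowup.BlowupExists := by
  by_contra hne
  apply h
  intro c
  refine ⟨?_, ?_⟩
  · intro hc u hanc hmeas hdss hdec
    by_contra hnt
    exact hne (filamentSkeletonRss_rdssProfileTruncation_proof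
      ⟨c, LinearIsometryEquiv.refl ℝ (EuclideanSpace ℝ (Fin 3)), u, hc, hanc, hmeas, isRotatedDSS_refl_iff.mpr hdss, hdec, hnt⟩)
  · intro R hc u hanc hmeas hdss hdec
    by_contra hnt
    exact hne (filamentSkeletonRss_rdssProfileTruncation_proof ⟨c, R, u, hc, hanc, hmeas, hdss, hdec, hnt⟩)

/-- W3 decides: X5a refutes Clay (A) (route Blowup's `closes` with the landed X5b). [folklore] -/
theorem W3_decides (h : Blowup.BlowupExists) : ¬ _root_.NavierStokesRegularity :=
  Blowup.closes h Blowup.BlowupClayUniqueness_holds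

/-- Hence W1 decides too. [folklore] -/
theorem W1_decides (h : Blowup.BlowupTypeIDssProfile) : ¬ _root_.NavierStokesRegularity :=
  W3_decides (W1_imp_W3 h)

/-- W5 (drop DSS): the crux negates the kill switch `PolyhedralTypeILiouville` (stmt-1405) —
landed glue `LiouvilleKillsProfile` (stmt-1408) read contrapositively. W5 is WEAKER than C but
cannot stand in `closes`: no tree theorem turns a bounded ancient solution into a blow-up. [folklore] -/
theorem crux_imp_W5 (hX : QuantisedSymmetry.PolyhedralDssProfileExists) :
    ¬ QuantisedSymmetry.PolyhedralTypeILiouville :=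
  fun h3 => quantisedSymmetry_liouvilleKillsProfile_proof h3 hX

/-! ## §2 The best honest split: selection through W5 -/

/-- Piece 1 (`SelT`): the polyhedral Type-I bounded ancient class is nonempty (= ¬ kill switch). -/
def SelT : Prop := ¬ QuantisedSymmetry.PolyhedralTypeILiouville

/-- Piece 2 (`SelDss`, "DSS selection"): if the polyhedral Type-I bounded ancient class is
nonempty, it contains a discretely self-similar member (the crux's witness). -/
def SelDss : Prop :=
  ¬ QuantisedSymmetry.PolyhedralTypeILiouville → QuantisedSymmetry.PolyhedralDssProfileExists

/-- Assembly of the split (modus ponens; `trivial_seam`). [folklore] -/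
theorem crux_of_split (h₁ : SelT) (h₂ : SelDss) : QuantisedSymmetry.PolyhedralDssProfileExists :=
  h₂ h₁

/-- Piece 1 is NECESSARY (so it is not decoration): `C → SelT`. [folklore] -/
theorem selT_of_crux (hX : QuantisedSymmetry.PolyhedralDssProfileExists) : SelT := crux_imp_W5 hX

/-- Piece 2 is NECESSARY (trivially): `C → SelDss`. [folklore] -/
theorem selDss_of_crux (hX : QuantisedSymmetry.PolyhedralDssProfileExists) : SelDss := fun _ => hX

/-! ## §3 The rigid strengthening is refuted -/

/-- `S⁺`: a polyhedrally equivariant Type-I profile which is λ-DSS for EVERY λ > 1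
(λ-continuous, i.e. Leray self-similar) — the form that would admit ODE/elliptic tools. -/
def SteadyPolyhedralProfileExists : Prop :=
  ∃ G : Subgroup ((EuclideanSpace ℝ (Fin 3)) ≃ₗᵢ[ℝ] (EuclideanSpace ℝ (Fin 3))), Finite G ∧
    (∀ g ∈ G, LinearMap.det (g.toLinearEquiv : (EuclideanSpace ℝ (Fin 3)) →ₗ[ℝ] (EuclideanSpace ℝ (Fin 3))) = 1) ∧
    (∀ V : Submodule ℝ (EuclideanSpace ℝ (Fin 3)), (∀ g ∈ G, ∀ v ∈ V, g v ∈ V) → V = ⊥ ∨ V = ⊤) ∧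
    ∃ u : ℝ → (EuclideanSpace ℝ (Fin 3)) → (EuclideanSpace ℝ (Fin 3)), IsAncientMildSolution 1 u ∧ (∀ t < 0, AEStronglyMeasurable (u t) volume) ∧
      (∀ c : ℝ, 1 < c → IsDiscretelySelfSimilar c u) ∧ (∃ C₀ : ℝ, HasTypeIDecay C₀ u) ∧
      (∀ g ∈ G, ∀ t x, u t (g x) = g (u t x)) ∧ ¬ (∀ t < 0, u t =ᵐ[volume] 0)

/-- `S⁺ → C` (take `λ = 2`). [folklore] -/
theorem crux_of_steady (h : SteadyPolyhedralProfileExists) :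
    QuantisedSymmetry.PolyhedralDssProfileExists := by
  obtain ⟨G, hfin, hdet, hirr, u, hanc, hmeas, hdss, hdec, heqv, hnt⟩ := h
  exact ⟨G, hfin, hdet, hirr, 2, by norm_num, u, hanc, hmeas, hdss 2 (by norm_num), hdec, heqv, hnt⟩

/-- `¬S⁺`: REFUTED in the tree — a profile that is DSS for every factor is DSS for a factor inside
the Chae–Wolf window (landed N1 `stub_periodWindow`, Chae–Wolf 2017 Thm 1.3 on the crux's class),
the case of a non-positive Type-I constant being the landed N2 `stub_noSmallConstant`.
(NRŠ 1996 / Tsai 1998 in DSS clothes.) [folklore] -/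
theorem not_steady : ¬ SteadyPolyhedralProfileExists := by
  rintro ⟨G, -, -, -, u, hanc, hmeas, hdss, ⟨C₀, hdec⟩, -, hnt⟩
  apply hnt
  obtain ⟨ε, hε, hsmall⟩ := PolyhedralDssProfileExists.PolyhedralCell.stub_noSmallConstant
  by_cases hC : C₀ ≤ ε
  · exact hsmall u C₀ hanc hmeas hdec hC
  · have hC₀ : 0 < C₀ := lt_of_lt_of_le hε (le_of_lt (lt_of_not_ge hC))
    obtain ⟨c₁, hc₁, hwin⟩ := PolyhedralDssProfileExists.PolyhedralCell.stub_periodWindow C₀ hC₀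
    -- a factor strictly inside the window (1, c₁)
    have hmid₁ : 1 < (1 + c₁) / 2 := by linarith
    have hmid₂ : (1 + c₁) / 2 < c₁ := by linarith
    exact hwin ((1 + c₁) / 2) u hmid₁ hmid₂ hanc hmeas (hdss _ hmid₁) hdec

end Summit.NavierStokesRegularity.NavierStokesRegularity.Cruxes.PolyhedralDssProfileExists.S21g15
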